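import Summits.HodgeConjecture.HodgeConjecture.Theorems.F0P2gStubNSILocalLemmas
import Literature.NumberTheory.Automorphic.UnitaryGroupNonsplitPlace
import Literature.NumberTheory.Automorphic.UnitaryGroupLocalNormFormCoercive
import Literature.NumberTheory.Automorphic.QuadraticLocalBaseChange
import Literature.NumberTheory.Automorphic.QuadraticAdeleBaseChange
import Literature.NumberTheory.Automorphic.GlobalAdditiveCharacterProofs
import Literature.NumberTheory.Automorphic.AddCharConductorExponent
import Literature.NumberTheory.GelbartRogawski1991.QuadExtSplittingCharLocalComponents
import Literature.NumberTheory.GaloisRepresentations.FrobeniusDensityTheorem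
import Summits.HodgeConjecture.CorCM.B01.Transposition.Item6OmegaChiSplitting
import HarnessLib

/-!
# FLOOR-0 P2 — ROAD δ, file δ3 (part 1 of 2, assembly): stub NSI `stub_NSI_nontrivialClassNotSpherical` of the rung-3 sub-line
# `Cruxes/H413/Lines/F0_P2PKRung3.lean` (crux item stmt-HodgeConjecture-24833 `HCCMUnconditional.H413`, binder `h413 ⇐ hdictE`) MODULO the
# integral uncertainty principle (CORE′) — `stubNSI_of_core`

Cell hodgecm-mathlib (D-0151), FLOOR 0, programme P2 (theta ∕ `hdictE`); ROAD δ (director s484, F0P2-p01 (g4) CUT 2026-08-31T05:50Z, spec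
`F0/P2/ROAD-DELTA-spec.F0P2p01g4.md`): δ1 ★ `HeisenbergGroup/SchwartzBruhatLatticeUncertainty` (B-p10), δ2 `UnitaryGroupOddLineNoIntegralEigenvector`
(F0P2-p01; head (CORE′) `UnitaryGroup.eq_zero_of_forall_implementer_eigen_of_odd`, statement of record `F0/P2/CORE-PRIME-statement.F0P2-plan-g5.lean`
sha16 bfd703e5148569fd), δ3 = this file + the closer (seat B-p18 (g24)).  THEOREMS ONLY (no `def`, no instance, no notation, no named fact, no
`sorry`); never imports a `Cruxes/…/Lines` module: the body of `F0P2PKRung3.StubNSINontrivialClassNotSpherical` (tree v1.1 :208–231) is RESTATED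
VERBATIM as the conclusion of `stubNSI_of_core`, whose only hypothesis `hcore` is (CORE′) in the EXACT binder shape of the statement of record; part 2
(`Theorems/F0P2gStubNSINontrivialClassNotSpherical.lean :: stubNSI_holds`) is `stubNSI_of_core` applied to δ2's head the hour it lands.

WHAT NSI SAYS.  For a CM field `L` (`L⁺ = maximalRealSubfield L`, `c = complexConj`), a frame `e₁ : Fin 3 × Fin 1 ≃ Fin n'`, a real non-degenerate
diagonal `dV`, a conjugate-symplectic `μ` and `χ`: at all but finitely many finite places `v` of `L⁺`, for EVERY `ε ∈ (L⁺)ˣ`, if Liu's local theta type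
`X_v(μ, ε, χ)` — the `χ_{1,v}`-coinvariants of the local Weil representation `ω_v` of `𝓢_ε = chiLocalSplittingsD … ε` under the centre `U(JW ε)(L⁺_v) = L_v¹`,
restricted along `k ↦ k ⊗ 1 : U(diag dV)(L⁺_v) → U(diag dV ⊗ JW ε)(L⁺_v)` — has a `U(diag dV)(𝒪_v)`-spherical line, then `[ε]_v = 1` in `L⁺_vˣ ∕ N(L_vˣ)`.

PROOF (§2–§3 in `Theorems/F0P2gStubNSILocalLemmas.lean`, §4 here).
* §2 (generic dual pair `U(J_V) × U(J_W)`, `J_W` a line, ANY family of local splittings `𝓢`, ANY centre character `χ₁`):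
  `exists_ne_zero_fixed_of_isSpherical_coinv` — a `U(J_V)(𝒪_v)`-spherical line of the coinvariant quotient lifts to a NON-ZERO Schwartz–Bruhat function
  FIXED by `ω_v(u ⊗ 1)`, `u ∈ U(J_V)(𝒪_v)` (★ p812544 `TwistedCoinv.exists_ne_zero_mem_fixedPoints_of_ne_bot`: `K`-fixed points are exact along the compact
  open `U(J_V)(𝒪_v)` ★ `isOpen_localInt`∕`isCompact_localInt` for the smooth `ω_v ∘ (k ↦ k ⊗ 1)`, ★ `continuous_localLineInl`);
  `forall_implementer_eigen_of_fixed` — such a function is an EIGENVECTOR of EVERY implementer `M` of `ι_v(k)` for every `k ∈ U(J_V ⊗ J_W)(𝒪_v)`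
  (`k = u ⊗ 1`, ★ `localLineInl_surjective` + `mem_localInt_of_localLineInl_mem`, the converse of ★ `localLineInl_mapsTo_localInt`; `ω_v(k)` implements
  `ι_v(k)` by the field `proj_s`; implementers differ by scalars, ★ `implementerUniqueUpToScalar_localSchrodinger`).
* §3 the norm-class dictionary for `locF`: `[a]_v = 1 ↔ a ∈ N_v` (definitional); `= 1` when `d` is a square in `F_v` (★ `quadraticNormSubgroup_eq_top_of_isSquare`);
  `↔ ord_v a` even at an unramified inert `v` (★ `mem_quadraticNormSubgroup_iff_even_of_isUnramifiedIn`, O'Meara 63:16); CM instance (`δ ∉ L⁺`).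
* §4 `locF_eq_one_of_isSpherical_of_smul_eq` (the INERT step: `L ⊗ L⁺_v` a field ★ `LocalRing.isField_of_smul_eq`, `δ²` a non-square ★
  `mul_self_ne_d_of_isField`; were `[ε]_v ≠ 1`, `ord_v ε` would be odd, the diagonal Gram entries `dV_j · ε` of `gram L⁺ e₁ (diag dV) (ε)` would all have
  odd order, and (CORE′) kills the fixed function of §2) and the assembly `stubNSI_of_core` over the cofinite good places (★ `finite_setOf_not_isUnramifiedIn`,
  ★ `eventually_valued_algebraMap_eq_one`, ★ `eventually_hasConductorExp_zero_adicComponent_adeleAddChar`; Mathlib↔tree currency ★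
  `normAbs_eq_inv_zpow_of_valued_eq`), the split places being ★ `isSquare_of_smul_ne`.

`--kind proof --supports stmt-HodgeConjecture-24833 --as helper`.  HONEST LABEL: this file discharges nothing printed and does NOT close NSI — it closes NSI
MODULO (CORE′), which δ2 proves; HC_CM is proved only modulo the printed citations until rung 0 closes.

## References
* [GelbartRogawski1991] S. Gelbart, J. Rogawski, Invent. Math. 105 (1991): Lem. 5.1.2 p. 466, p. 467 L25–27 (the member of `Π(ξ_v)` at the class
  without a self-dual lattice is supercuspidal), §3.1 Prop. 3.1.1 p. 455.
* [HarrisKudlaSweet1996] M. Harris, S. Kudla, W. Sweet, J. AMS 9 (1996): Thm. 6.1 (unramified dichotomy).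
* [Omeara1963] O. T. O'Meara, *Introduction to Quadratic Forms* (1963): §63C Example 63:16, §63B 63:13a, §65A.
* [BernsteinZelevinsky1976] I. N. Bernstein, A. V. Zelevinsky, Russian Math. Surveys 31 (1976): §2.1–2.3.
* [MoeglinVignerasWaldspurger1987] C. Mœglin, M.-F. Vignéras, J.-L. Waldspurger, LNM 1291 (1987): Chap. 2 II.1 (A).
* [PlatonovRapinchuk1994] V. Platonov, A. Rapinchuk, *Algebraic Groups and Number Theory* (1994): §5.1.
* [Liu2021] Y. Liu, Camb. J. Math. 9 (2021): Def. 4.11–4.12 (l. 2083–2108), App. D §D.1.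
-/

set_option autoImplicit false
-- the mandated namespace has the single-problem summit's repeated segment (`HodgeConjecture.HodgeConjecture`)
set_option linter.dupNamespace false

noncomputable section

open NumberField MeasureTheory IsDedekindDomain Set
open scoped Matrix Kronecker ComplexOrder NNReal

namespace Summit.HodgeConjecture.HodgeConjecture.Cruxes.H413.F0P2gStubNSIOfCore

open Literature.NumberTheory Literature.NumberTheory.Automorphic Literature.NumberTheory.Automorphic.UnitaryGroup
open Literature.NumberTheory.Automorphic.IdeleClassGroup
open Literature.NumberTheory.Automorphic.Liu2021 Literature.NumberTheory.Automorphic.Liu2021.Def411WeilCarriers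
open Literature.NumberTheory.GelbartRogawski1991 Literature.NumberTheory.GelbartRogawski1991.UnitaryDualPair
open Literature.NumberTheory.GelbartRogawski1991.UnitaryDualPair.WeilCoinv
open Literature.NumberTheory.GelbartRogawski1991.UnitaryDualPair.LocalSplitting
open Literature.NumberTheory.QuadraticForms
open Literature.NumberTheory.GaloisRepresentations.IsNonarchimedeanLocalField
open Literature.RepresentationTheory Literature.RepresentationTheory.Liu2021 Literature.RepresentationTheory.HeisenbergGroup
open Summit.HodgeConjecture.CorCM.Transposition

open Summit.HodgeConjecture.HodgeConjecture.Cruxes.H413.F0P2gStubNSILocalLemmas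

/-! ## §4 The closer modulo (CORE′): `stubNSI_of_core` -/

section Assembly

/-- `reindex e (diag a ⊗ (t)) = diag (i ↦ a (e⁻¹ i).1 · t)` — the Gram matrix of `V ⊗ ⟨t⟩` in the frame `e` is diagonal.
[folklore] -/
theorem reindex_diagonal_kronecker_single {R : Type*} [CommRing R] {N n : ℕ} (e : Fin N × Fin 1 ≃ Fin n) (a : Fin N → R) (t : R) :
    Matrix.reindex e e (Matrix.diagonal a ⊗ₖ !![t]) = Matrix.diagonal fun i => a (e.symm i).1 * t := by
  have h1 : (!![t] : Matrix (Fin 1) (Fin 1) R) = Matrix.diagonal fun _ => t := by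
    ext i j; fin_cases i; fin_cases j; rfl
  rw [h1, Matrix.diagonal_kronecker_diagonal, Matrix.reindex_apply, Matrix.submatrix_diagonal_equiv]
  rfl

/-- two distinct indices through a frame enumeration `e₁ : Fin 3 × Fin 1 ≃ Fin n'`. [folklore] -/
theorem equiv_apply_ne {n' : ℕ} (e₁ : Fin 3 × Fin 1 ≃ Fin n') : e₁ (0, 0) ≠ e₁ (1, 0) :=
  fun h => absurd (congrArg Prod.fst (e₁.injective h)) (by decide)

variable (L : Type) [Field L] [NumberField L] [IsCMField L]

/-- the Gram matrix `gram L⁺ e₁ (diag dV) (ε)` of `V ⊗ ⟨ε⟩` is the diagonal matrix of the `dV_{e₁⁻¹ i} · ε`. [folklore] -/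
theorem gram_realDiagonal_TW_eq_diagonal {n' : ℕ} (e₁ : Fin 3 × Fin 1 ≃ Fin n') (dV : Fin 3 → L)
    (hdV : ∀ i, IsCMField.complexConj L (dV i) = dV i) (ε : (↥(maximalRealSubfield L))ˣ) :
    gram (↥(maximalRealSubfield L)) e₁ (realDiagonal L dV hdV) (TW (↥(maximalRealSubfield L)) ε) =
      Matrix.diagonal fun i => (⟨dV (e₁.symm i).1, (IsCMField.complexConj_eq_self_iff (K := L) _).1 (hdV _)⟩ : ↥(maximalRealSubfield L)) * (ε : ↥(maximalRealSubfield L)) :=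
  reindex_diagonal_kronecker_single e₁ _ _

-- HB: the NSI statement (pasted verbatim from `Cruxes/H413/Lines/F0_P2PKRung3.lean`, which elaborates it under `maxHeartbeats 8000000`)
-- elaborates here under 1 000 000 and not under 400 000 (probe 2026-08-31); ×2 margin on the two declarations carrying it.
set_option synthInstance.maxHeartbeats 400000 in
set_option maxHeartbeats 2000000 in
/-- **the INERT place step of NSI, modulo (CORE′)**: at a place `v` of `L⁺` unramified in `L`, with `2`, `δ²` and all `dV i` units and `ψ_v`
of conductor `𝒪_v`, and NON-SPLIT (`c • w = w` for a place `w ∣ v`): if `X_v(μ, ε, χ)` has a `U(diag dV)(𝒪_v)`-spherical line then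
`[ε]_v = 1`.  (§2 lifts the line to a non-zero Schwartz–Bruhat function fixed by `ω_v(u ⊗ 1)`, `u` integral, hence an eigenvector of every
implementer of `ι_v(k)`, `k` integral; were `[ε]_v ≠ 1`, `ord_v ε` would be odd (§3) and (CORE′) would kill the function.)
[cite: GelbartRogawski1991, Lem 5.1.2 p. 466, p. 467] [cite: Omeara1963, §63C Example 63:16] -/
theorem locF_eq_one_of_isSpherical_of_smul_eq
    (hcore : ∀ {F : Type} [Field F] [NumberField F] (E : Type) [Field E] [NumberField E] [Algebra F E] [Algebra.IsQuadraticExtension F E]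
      (c : E ≃ₐ[F] E) (N : ℕ) (J : Matrix (Fin N) (Fin N) E) (v : HeightOneSpectrum (𝓞 F)) {δ : E} (hcδ : c δ = -δ) (hδ : δ ≠ 0)
      {d : F} (hd : δ * δ = algebraMap F E d) (T : Matrix (Fin N) (Fin N) F) (hT : T.IsSymm) (hJ : J = T.map (algebraMap F E))
      (tD : Fin N → F) (_hTD : T = Matrix.diagonal tD) (i₁ i₂ : Fin N) (_hi : i₁ ≠ i₂) (_hE : IsField (UnitaryGroup.LocalRing E v))
      (_h2 : normAbs (v.adicCompletion F) (2 : v.adicCompletion F) = 1)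
      (_hdv : normAbs (v.adicCompletion F) (algebraMap F (v.adicCompletion F) d) = 1) (_hψ : (adeleAddCharAt F v).HasConductorExp 0)
      (m : ℤ) (_hm : ∀ i, normAbs (v.adicCompletion F) (algebraMap F (v.adicCompletion F) (tD i)) =
        ((residueFieldCard (v.adicCompletion F) : ℝ≥0)⁻¹) ^ m) (_hodd : Odd m)
      (f : SchwartzBruhat (Fin N → v.adicCompletion F)),
      (∀ k ∈ localInt E c N J v,
        ∀ M : SchwartzBruhat (Fin N → v.adicCompletion F) ≃ₗ[ℂ] SchwartzBruhat (Fin N → v.adicCompletion F),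
          (iota F E c N hcδ hδ hd T hT hJ v k, M) ∈ MpPsi (localSchrodinger F N T v) → ∃ a : ℂ, M f = a • f) →
      f = 0)
    {n' : ℕ} (e₁ : Fin 3 × Fin 1 ≃ Fin n') (dV : Fin 3 → L)
    (hdV : ∀ i, IsCMField.complexConj L (dV i) = dV i) (hdV0 : ∀ i, dV i ≠ 0)
    (μ : Literature.NumberTheory.Automorphic.IdeleClassGroup L →ₜ* Circle) (hμ : IsConjugateSymplectic L μ)
    (χ : Chi (↥(maximalRealSubfield L)) L (IsCMField.complexConj L)) (v : HeightOneSpectrum (𝓞 ↥(maximalRealSubfield L)))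
    (hunr : Algebra.IsUnramifiedIn (𝓞 L) v.asIdeal) (h2v : Valued.v (2 : v.adicCompletion ↥(maximalRealSubfield L)) = 1)
    (hdv : Valued.v (algebraMap (↥(maximalRealSubfield L)) (v.adicCompletion ↥(maximalRealSubfield L)) (imagUnitSq L)) = 1)
    (hψ : (adeleAddCharAt (↥(maximalRealSubfield L)) v).HasConductorExp 0)
    (hdVv : ∀ i, Valued.v (algebraMap (↥(maximalRealSubfield L)) (v.adicCompletion ↥(maximalRealSubfield L))
      (⟨dV i, (IsCMField.complexConj_eq_self_iff (K := L) (dV i)).1 (hdV i)⟩ : ↥(maximalRealSubfield L))) = 1)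
    (w : PlacesOver L v) (hw : IsCMField.complexConj L • w.1 = w.1) (ε : (↥(maximalRealSubfield L))ˣ)
    (hsph : Representation.IsSpherical
                (show Representation ℂ (localPi L (IsCMField.complexConj L) 3 (Matrix.diagonal dV) v) _ from
                  (TwistedCoinv.rep (localCharOfCenter (↥(maximalRealSubfield L)) L (IsCMField.complexConj L)
                      (JW (↥(maximalRealSubfield L)) L ε) (JW_apply_ne_zero (↥(maximalRealSubfield L)) L ε) χ.1 v)
                    ((OmegaChiSplitting.chiLocalSplittingsD ⟨L⟩ e₁ dV hdV hdV0 (toHeckeCharacter L μ)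
                      ((isOscillatorChar_toHeckeCharacter_iff μ).mpr hμ) ε).omegaLoc v)
                    (commute_omegaLoc_localCenter (↥(maximalRealSubfield L)) L (IsCMField.complexConj L) 3 e₁ (Matrix.diagonal dV)
                      (JW (↥(maximalRealSubfield L)) L ε) (complexConj_imagUnit L) (imagUnit_ne_zero L) (imagUnit_mul_self L)
                      (realDiagonal_isSymm L dV hdV) (isSymm_TW (↥(maximalRealSubfield L)) ε) (realDiagonal_map L dV hdV).symm
                      (JW_eq (↥(maximalRealSubfield L)) L ε) (JW_apply_ne_zero (↥(maximalRealSubfield L)) L ε)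
                      (OmegaChiSplitting.chiLocalSplittingsD ⟨L⟩ e₁ dV hdV hdV0 (toHeckeCharacter L μ)
                        ((isOscillatorChar_toHeckeCharacter_iff μ).mpr hμ) ε) v)).comp
                    (UnitaryGroup.localLineInl L (IsCMField.complexConj L) 3 e₁ (Matrix.diagonal dV) (JW (↥(maximalRealSubfield L)) L ε) v))
        (localInt L (IsCMField.complexConj L) 3 (Matrix.diagonal dV) v)) :
    locF (↥(maximalRealSubfield L)) (imagUnitSq L) ε v = 1 := by
  have hc1 : IsCMField.complexConj L ≠ 1 := IsCMField.complexConj_ne_one L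
  -- `L ⊗ L⁺_v` is a field and `δ²` is not a square in `L⁺_v`
  have hE : IsField (UnitaryGroup.LocalRing L v) := LocalRing.isField_of_smul_eq (IsCMField.complexConj L) hc1 w hw
  have hcoe : ((imagUnitSq L : ↥(maximalRealSubfield L)) : v.adicCompletion ↥(maximalRealSubfield L)) = algebraMap (↥(maximalRealSubfield L)) (v.adicCompletion ↥(maximalRealSubfield L)) (imagUnitSq L) := rfl
  have hnsq : ¬ IsSquare (algebraMap (↥(maximalRealSubfield L)) (v.adicCompletion ↥(maximalRealSubfield L)) (imagUnitSq L)) := by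
    rintro ⟨r, hr⟩
    rw [← hcoe] at hr
    exact mul_self_ne_d_of_isField L (IsCMField.complexConj L) (complexConj_imagUnit L) (imagUnit_ne_zero L)
      (imagUnit_mul_self L) v hE r hr.symm
  by_contra hne
  have hodd := odd_log_valued_of_locF_ne_one L hunr hnsq hne
  -- §2: a non-zero fixed Schwartz–Bruhat function …
  obtain ⟨f, hf0, hf⟩ := exists_ne_zero_fixed_of_isSpherical_coinv (↥(maximalRealSubfield L)) L (IsCMField.complexConj L) 3 e₁
    (Matrix.diagonal dV) (JW (↥(maximalRealSubfield L)) L ε) (complexConj_imagUnit L) (imagUnit_ne_zero L) (imagUnit_mul_self L)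
    (realDiagonal_isSymm L dV hdV) (isSymm_TW (↥(maximalRealSubfield L)) ε) (realDiagonal_map L dV hdV).symm
    (JW_eq (↥(maximalRealSubfield L)) L ε) (JW_apply_ne_zero (↥(maximalRealSubfield L)) L ε)
    (OmegaChiSplitting.chiLocalSplittingsD ⟨L⟩ e₁ dV hdV hdV0 (toHeckeCharacter L μ) ((isOscillatorChar_toHeckeCharacter_iff μ).mpr hμ) ε)
    v _ hsph
  -- … which is an eigenvector of every implementer of `ι_v(k)`, `k` integral
  have heig := forall_implementer_eigen_of_fixed (↥(maximalRealSubfield L)) L (IsCMField.complexConj L) 3 e₁ (Matrix.diagonal dV)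
    (JW (↥(maximalRealSubfield L)) L ε) (complexConj_imagUnit L) (imagUnit_ne_zero L) (imagUnit_mul_self L)
    (realDiagonal_isSymm L dV hdV) (isSymm_TW (↥(maximalRealSubfield L)) ε) (realDiagonal_map L dV hdV).symm
    (JW_eq (↥(maximalRealSubfield L)) L ε) (JW_apply_ne_zero (↥(maximalRealSubfield L)) L ε)
    (OmegaChiSplitting.chiLocalSplittingsD ⟨L⟩ e₁ dV hdV hdV0 (toHeckeCharacter L μ) ((isOscillatorChar_toHeckeCharacter_iff μ).mpr hμ) ε)
    (isUnit_det_realDiagonal L dV hdV hdV0) (isUnit_det_TW (↥(maximalRealSubfield L)) ε) v f hf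
  -- the good-place data in the `normAbs` currency of (CORE′)
  have h2' : normAbs (v.adicCompletion ↥(maximalRealSubfield L)) (2 : v.adicCompletion ↥(maximalRealSubfield L)) = 1 := by
    rw [normAbs_eq_inv_zpow_of_valued_eq v (n := 0) (by rw [h2v, WithZero.exp_zero]), neg_zero, zpow_zero]
  have hdv' : normAbs (v.adicCompletion ↥(maximalRealSubfield L)) (algebraMap (↥(maximalRealSubfield L)) (v.adicCompletion ↥(maximalRealSubfield L)) (imagUnitSq L)) = 1 := by
    rw [normAbs_eq_inv_zpow_of_valued_eq v (n := 0) (by rw [hdv, WithZero.exp_zero]), neg_zero, zpow_zero]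
  -- the common order `m = ord_v ε` of the diagonal Gram entries `dV_j · ε` (in the `normAbs` currency: `‖dV_j ε‖ = q_v^{-(-log |ε|_v)}`)
  have hε0 : Valued.v (algebraMap (↥(maximalRealSubfield L)) (v.adicCompletion ↥(maximalRealSubfield L)) (ε : ↥(maximalRealSubfield L))) ≠ 0 :=
    (Valuation.ne_zero_iff _).2 ((map_ne_zero _).2 ε.ne_zero)
  have hm : ∀ i : Fin n', normAbs (v.adicCompletion ↥(maximalRealSubfield L)) (algebraMap (↥(maximalRealSubfield L)) (v.adicCompletion ↥(maximalRealSubfield L))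
      ((⟨dV (e₁.symm i).1, (IsCMField.complexConj_eq_self_iff (K := L) _).1 (hdV _)⟩ : ↥(maximalRealSubfield L)) * (ε : ↥(maximalRealSubfield L)))) =
        ((residueFieldCard (v.adicCompletion ↥(maximalRealSubfield L)) : ℝ≥0)⁻¹) ^
          (-WithZero.log (Valued.v (algebraMap (↥(maximalRealSubfield L)) (v.adicCompletion ↥(maximalRealSubfield L)) (ε : ↥(maximalRealSubfield L))))) := fun i =>
    normAbs_eq_inv_zpow_of_valued_eq v (by rw [map_mul, map_mul, hdVv, one_mul, WithZero.exp_log hε0])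
  -- (CORE′)
  exact hf0 (hcore L (IsCMField.complexConj L) n' (Matrix.reindex e₁ e₁ (Matrix.diagonal dV ⊗ₖ JW (↥(maximalRealSubfield L)) L ε)) v
    (complexConj_imagUnit L) (imagUnit_ne_zero L) (imagUnit_mul_self L)
    (gram (↥(maximalRealSubfield L)) e₁ (realDiagonal L dV hdV) (TW (↥(maximalRealSubfield L)) ε))
    (isSymm_gram (↥(maximalRealSubfield L)) e₁ (realDiagonal_isSymm L dV hdV) (isSymm_TW (↥(maximalRealSubfield L)) ε))
    (reindex_kronecker_eq_gram_map (↥(maximalRealSubfield L)) L e₁ (realDiagonal_map L dV hdV).symm (JW_eq (↥(maximalRealSubfield L)) L ε))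
    _ (gram_realDiagonal_TW_eq_diagonal L e₁ dV hdV ε) (e₁ (0, 0)) (e₁ (1, 0)) (equiv_apply_ne e₁) hE h2' hdv' hψ
    _ hm hodd.neg f heig)

set_option synthInstance.maxHeartbeats 400000 in
set_option maxHeartbeats 2000000 in
/-- **NSI modulo (CORE′)** — the registered body of `F0P2PKRung3.StubNSINontrivialClassNotSpherical` VERBATIM, from the integral
uncertainty principle (CORE′) of ROAD δ taken as the hypothesis `hcore` in the EXACT binder shape of the statement of record
`F0/P2/CORE-PRIME-statement.F0P2-plan-g5.lean` (sha16 bfd703e5148569fd; δ2's head `UnitaryGroup.eq_zero_of_forall_implementer_eigen_of_odd`).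
Cofinitely many places `v` of `L⁺` are unramified in `L` with `2`, `δ²` and every `dV i` a `v`-unit and `ψ_v` of conductor `𝒪_v`
(★ `finite_setOf_not_isUnramifiedIn`, ★ `eventually_valued_algebraMap_eq_one`, ★ `eventually_hasConductorExp_zero_adicComponent_adeleAddChar`);
at such a `v`: a split `v` (`c • w ≠ w`) has only the trivial class (§3, ★ `isSquare_of_smul_ne`), an inert `v` is
`locF_eq_one_of_isSpherical_of_smul_eq`.
[cite: GelbartRogawski1991, Lem 5.1.2 p. 466, p. 467] [cite: HarrisKudlaSweet1996, Thm 6.1] [cite: Omeara1963, §63C Example 63:16] -/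
theorem stubNSI_of_core
    (hcore : ∀ {F : Type} [Field F] [NumberField F] (E : Type) [Field E] [NumberField E] [Algebra F E] [Algebra.IsQuadraticExtension F E]
      (c : E ≃ₐ[F] E) (N : ℕ) (J : Matrix (Fin N) (Fin N) E) (v : HeightOneSpectrum (𝓞 F)) {δ : E} (hcδ : c δ = -δ) (hδ : δ ≠ 0)
      {d : F} (hd : δ * δ = algebraMap F E d) (T : Matrix (Fin N) (Fin N) F) (hT : T.IsSymm) (hJ : J = T.map (algebraMap F E))
      (tD : Fin N → F) (_hTD : T = Matrix.diagonal tD) (i₁ i₂ : Fin N) (_hi : i₁ ≠ i₂) (_hE : IsField (UnitaryGroup.LocalRing E v))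
      (_h2 : normAbs (v.adicCompletion F) (2 : v.adicCompletion F) = 1)
      (_hdv : normAbs (v.adicCompletion F) (algebraMap F (v.adicCompletion F) d) = 1) (_hψ : (adeleAddCharAt F v).HasConductorExp 0)
      (m : ℤ) (_hm : ∀ i, normAbs (v.adicCompletion F) (algebraMap F (v.adicCompletion F) (tD i)) =
        ((residueFieldCard (v.adicCompletion F) : ℝ≥0)⁻¹) ^ m) (_hodd : Odd m)
      (f : SchwartzBruhat (Fin N → v.adicCompletion F)),
      (∀ k ∈ localInt E c N J v,
        ∀ M : SchwartzBruhat (Fin N → v.adicCompletion F) ≃ₗ[ℂ] SchwartzBruhat (Fin N → v.adicCompletion F),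
          (iota F E c N hcδ hδ hd T hT hJ v k, M) ∈ MpPsi (localSchrodinger F N T v) → ∃ a : ℂ, M f = a • f) →
      f = 0) :
    ∀ (L : Type) [Field L] [NumberField L] [IsCMField L] {n' : ℕ} (e₁ : Fin 3 × Fin 1 ≃ Fin n') (dV : Fin 3 → L)
      (hdV : ∀ i, IsCMField.complexConj L (dV i) = dV i) (hdV0 : ∀ i, dV i ≠ 0)
      (μ : Literature.NumberTheory.Automorphic.IdeleClassGroup L →ₜ* Circle) (hμ : IsConjugateSymplectic L μ)
      (χ : Chi (↥(maximalRealSubfield L)) L (IsCMField.complexConj L)),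
      ∀ᶠ v in Filter.cofinite, ∀ ε : (↥(maximalRealSubfield L))ˣ,
        Representation.IsSpherical
                    (show Representation ℂ (localPi L (IsCMField.complexConj L) 3 (Matrix.diagonal dV) v) _ from
                      (TwistedCoinv.rep (localCharOfCenter (↥(maximalRealSubfield L)) L (IsCMField.complexConj L)
                          (JW (↥(maximalRealSubfield L)) L ε) (JW_apply_ne_zero (↥(maximalRealSubfield L)) L ε) χ.1 v)
                        ((OmegaChiSplitting.chiLocalSplittingsD ⟨L⟩ e₁ dV hdV hdV0 (toHeckeCharacter L μ)
                          ((isOscillatorChar_toHeckeCharacter_iff μ).mpr hμ) ε).omegaLoc v)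
                        (commute_omegaLoc_localCenter (↥(maximalRealSubfield L)) L (IsCMField.complexConj L) 3 e₁ (Matrix.diagonal dV)
                          (JW (↥(maximalRealSubfield L)) L ε) (complexConj_imagUnit L) (imagUnit_ne_zero L) (imagUnit_mul_self L)
                          (realDiagonal_isSymm L dV hdV) (isSymm_TW (↥(maximalRealSubfield L)) ε) (realDiagonal_map L dV hdV).symm
                          (JW_eq (↥(maximalRealSubfield L)) L ε) (JW_apply_ne_zero (↥(maximalRealSubfield L)) L ε)
                          (OmegaChiSplitting.chiLocalSplittingsD ⟨L⟩ e₁ dV hdV hdV0 (toHeckeCharacter L μ)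
                            ((isOscillatorChar_toHeckeCharacter_iff μ).mpr hμ) ε) v)).comp
                        (UnitaryGroup.localLineInl L (IsCMField.complexConj L) 3 e₁ (Matrix.diagonal dV) (JW (↥(maximalRealSubfield L)) L ε) v))
            (localInt L (IsCMField.complexConj L) 3 (Matrix.diagonal dV) v) →
          locF (↥(maximalRealSubfield L)) (imagUnitSq L) ε v = 1 := by
  intro L _ _ _ n' e₁ dV hdV hdV0 μ hμ χ
  have hd0 : imagUnitSq L ≠ 0 := fun h => imagUnit_ne_zero L (by
    have := imagUnit_mul_self L; rw [h, map_zero, mul_self_eq_zero] at this; exact this)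
  have hdV' : ∀ i, (⟨dV i, (IsCMField.complexConj_eq_self_iff (K := L) (dV i)).1 (hdV i)⟩ : ↥(maximalRealSubfield L)) ≠ 0 :=
    fun i h => hdV0 i (congrArg Subtype.val h)
  -- the cofinite good places
  have h_unr : ∀ᶠ v : HeightOneSpectrum (𝓞 ↥(maximalRealSubfield L)) in Filter.cofinite, Algebra.IsUnramifiedIn (𝓞 L) v.asIdeal :=
    Filter.eventually_cofinite.2 (GaloisRepresentations.finite_setOf_not_isUnramifiedIn (↥(maximalRealSubfield L)) L)
  have h_twov : ∀ᶠ v : HeightOneSpectrum (𝓞 ↥(maximalRealSubfield L)) in Filter.cofinite, Valued.v (2 : v.adicCompletion ↥(maximalRealSubfield L)) = 1 :=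
    (eventually_valued_algebraMap_eq_one (↥(maximalRealSubfield L)) (two_ne_zero : (2 : ↥(maximalRealSubfield L)) ≠ 0)).mono fun v hv => by rwa [map_ofNat] at hv
  have h_d : ∀ᶠ v : HeightOneSpectrum (𝓞 ↥(maximalRealSubfield L)) in Filter.cofinite,
      Valued.v (algebraMap (↥(maximalRealSubfield L)) (v.adicCompletion ↥(maximalRealSubfield L)) (imagUnitSq L)) = 1 :=
    eventually_valued_algebraMap_eq_one (↥(maximalRealSubfield L)) hd0
  have h_psi : ∀ᶠ v : HeightOneSpectrum (𝓞 ↥(maximalRealSubfield L)) in Filter.cofinite, (adeleAddCharAt (↥(maximalRealSubfield L)) v).HasConductorExp 0 :=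
    eventually_hasConductorExp_zero_adicComponent_adeleAddChar (K := ↥(maximalRealSubfield L))
  have h_dV : ∀ᶠ v : HeightOneSpectrum (𝓞 ↥(maximalRealSubfield L)) in Filter.cofinite, ∀ i,
      Valued.v (algebraMap (↥(maximalRealSubfield L)) (v.adicCompletion ↥(maximalRealSubfield L))
        (⟨dV i, (IsCMField.complexConj_eq_self_iff (K := L) (dV i)).1 (hdV i)⟩ : ↥(maximalRealSubfield L))) = 1 := by
    simp only [Filter.eventually_all]
    exact fun i => eventually_valued_algebraMap_eq_one (↥(maximalRealSubfield L)) (hdV' i)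
  filter_upwards [h_unr, h_twov, h_d, h_psi, h_dV] with v hunr h2v hdv hψ hdVv
  intro ε hsph
  obtain ⟨w⟩ := (inferInstance : Nonempty (PlacesOver L v))
  by_cases hw : IsCMField.complexConj L • w.1 = w.1
  · exact locF_eq_one_of_isSpherical_of_smul_eq L hcore e₁ dV hdV hdV0 μ hμ χ v hunr h2v hdv hψ hdVv w hw ε hsph
  · -- `v` split: every class is trivial
    have hsq := QuadExt.isSquare_of_smul_ne (↥(maximalRealSubfield L)) L (IsCMField.complexConj L) (imagUnit_mul_self L) v w hw
    exact locF_eq_one_of_isSquare L hsq ε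

end Assembly

end Summit.HodgeConjecture.HodgeConjecture.Cruxes.H413.F0P2gStubNSIOfCore

end
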